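import Literature.Computability.Cryptography.ChenQuantumLWEWindowVariation

/-!
# The shape factor of a window weight on Chen's chirped line: `Pr ≤ ((2 + log P)/√P)·V(w)‖w‖₁/‖w‖₂²` (T8, every width)

REPRODUCTION / ANALYSIS OF A CLAIMED RESULT UNDER ADJUDICATION (withdrawn): Yilei Chen, *Quantum
Algorithms for Lattice Problems*, IACR ePrint 2024/555, version of 2024-04-18 [ChenQuantumLattice2024]
(the version carrying the author's note that Step 9 contains a bug), Step 9 (§3.5.9, pp. 34–38) acting
on `|φ8.b⟩ = Σ_{j ∈ ℤ_P} e(-j²/P) |2D²j·b + v′ mod N⟩` (p. 35), `P = p₁Q`, `N = D²P`.  Bundle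
`papers/QuantumAdvantage/lwe-quantum-autopsy/`, Part 2 (`REPAIR-CENSUS.md` §1 theorem **T8**, §11),
sequel of `ChenQuantumLWEWindowVariation.lean`.
HONEST FRAMING: kernel-checked THEOREMS about states occurring in a WITHDRAWN algorithm — a
quantitative NEGATIVE result for window repairs, NOT summit progress, no cryptanalytic claim in either
direction, no new algorithm; quantum lower bounds are out of scope.

## What is proved

`ChenQuantumLWEWindowVariation` bounds the law of the hyperplane value for a weight `w` on an interval of
`W` line positions by the geometric mean of `W/P` (support) and `(2 + log P)²V(w)²/‖w‖₂²` (Abel +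
completion).  For a weight that is small on most of its support (a discrete Gaussian of width `σ ≪ W`,
or an untruncated one, `W = P`) the support bound is the wrong partner; the right one is the `ℓ¹` bound:

* `norm_profileDFT_le_sum_norm`, **`prob_profile_le_l1`** — for ANY non-zero profile `c`:
  `|ĉ(s)| ≤ ‖c‖₁`, hence `Pr[⟨b, u mod P⟩ = t] ≤ ‖c‖₁²/(P‖c‖₂²)` = `W_eff/P` with the EFFECTIVE WIDTH
  `W_eff = ‖c‖₁²/‖c‖₂² ≤ #supp c`.
* **`prob_chirpWeight_le_shape`**: for odd `P ≥ 2`, `b₀ = −1`, every weight `w ≠ 0` supported on an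
  interval of `W ≤ P` positions (any `W`, `W = P` allowed) and every value `t`:
  `Pr[t] ≤ ((2 + log P)/√P)·(V(w)·‖w‖₁/‖w‖₂²)` — the interval-indicator ceiling times the SHAPE
  FACTOR `V(w)‖w‖₁/‖w‖₂²` (`= 1` for an indicator; `→ 2√2` for a discrete Gaussian of any width
  `1 ≪ σ ≪ P`, by `intervalVariation_le_of_unimodal` and two Riemann sums — `REPAIR-CENSUS.md` §11).
* `prob_chirpWeight_shift_le_shape`: the same bound for the weight applied at ANY relative position
  `j₀` to the chirp (the unknown centre only translates the law); `Shape.prob_chirpWeight_le_shape`.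

## What is NOT here

The Riemann-sum evaluation of `‖w‖₁`, `‖w‖₂` for specific weights (census, by hand); the `log`;
lower bounds; multi-interval supports.
-/

namespace Literature.Computability.Cryptography.Chen2024

open scoped BigOperators

section Weight

variable (p₁ Q : ℕ+)

/-- `|ĉ(s)| ≤ ‖c‖₁` for every profile and every frequency. [folklore] -/
theorem norm_profileDFT_le_sum_norm (c : ZP p₁ Q → ℂ) (s : ZP p₁ Q) :
    ‖profileDFT p₁ Q c s‖ ≤ ∑ j, ‖c j‖ := by
  unfold profileDFT
  calc ‖∑ j, c j * (ZMod.stdAddChar (j * s) : ℂ)‖ ≤ ∑ j, ‖c j * (ZMod.stdAddChar (j * s) : ℂ)‖ :=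
        norm_sum_le _ _
    _ = ∑ j, ‖c j‖ := Finset.sum_congr rfl fun j _ => by
        rw [norm_mul, ZMod.stdAddChar_apply, Circle.norm_coe, mul_one]

/-- The `ℓ¹` norm of a translated weight. [folklore] -/
theorem sum_norm_sub_eq (w : ZP p₁ Q → ℂ) (j₀ : ZP p₁ Q) : ∑ j, ‖w (j - j₀)‖ = ∑ j, ‖w j‖ :=
  Fintype.sum_equiv (Equiv.subRight j₀) _ _ fun _ => rfl

/-- The `ℓ²` norm of a translated weight. [folklore] -/
theorem sum_norm_sq_sub_eq (w : ZP p₁ Q → ℂ) (j₀ : ZP p₁ Q) :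
    ∑ j, ‖w (j - j₀)‖ ^ 2 = ∑ j, ‖w j‖ ^ 2 :=
  Fintype.sum_equiv (Equiv.subRight j₀) _ _ fun _ => rfl

end Weight

section Line

variable (n : ℕ) (D p₁ Q : ℕ+) (b v' : Fin (n + 1) → ℤ)

/-- **Effective-width bound**: for ANY non-zero profile `c` (odd `P`, `b₀ = −1`) and every value `t`,
`Pr[⟨b, u mod P⟩ = t] ≤ ‖c‖₁²/(P·‖c‖₂²)`. [cite: ChenQuantumLattice2024, §3.5.9 pp. 35–38; folklore] -/
theorem prob_profile_le_l1 (hP : Odd ((p₁ * Q : ℕ+) : ℕ)) (hb : b 0 = -1) (c : ZP p₁ Q → ℂ)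
    (hc0 : ∑ j, ‖c j‖ ^ 2 ≠ 0) (t : ZP p₁ Q) :
    (∑ u ∈ Finset.univ.filter (fun u : Fin (n + 1) → ZN D p₁ Q => lineFun n D p₁ Q b u = t),
        weight (qft (profileKet n D p₁ Q b v' c)) u)
        / ∑ u, weight (qft (profileKet n D p₁ Q b v' c)) u
      ≤ (∑ j, ‖c j‖) ^ 2 / ((((p₁ * Q : ℕ+) : ℕ) : ℝ) * ∑ j, ‖c j‖ ^ 2) := by
  rw [prob_lineFun_eq n D p₁ Q b v' hP hb c hc0 t]
  gcongr
  exact norm_profileDFT_le_sum_norm p₁ Q c _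

/-- **T8 with the shape factor** — for odd `P ≥ 2`, `b₀ = −1`, EVERY weight `w ≠ 0` supported on an
interval of `W ≤ P` line positions (`W = P` allowed), EVERY hyperplane value `t` and every offset:
`Pr[⟨b, u mod P⟩ = t] ≤ ((2 + log P)/√P)·(V(w)·‖w‖₁/‖w‖₂²)`.
[cite: Korobov1992, Ch. I §2 Thm 2 and §3 Thm 3; ChenQuantumLattice2024, §3.5.9 pp. 35–38] -/
theorem prob_chirpWeight_le_shape (hP : Odd ((p₁ * Q : ℕ+) : ℕ)) (h2 : 2 ≤ ((p₁ * Q : ℕ+) : ℕ))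
    (hb : b 0 = -1) (A W : ℕ) (hW : W ≤ ((p₁ * Q : ℕ+) : ℕ)) (w : ZP p₁ Q → ℂ)
    (hw : ∀ j, j ∉ intervalWindow p₁ Q A W → w j = 0) (hw0 : ∑ j, ‖w j‖ ^ 2 ≠ 0) (t : ZP p₁ Q) :
    (∑ u ∈ Finset.univ.filter (fun u : Fin (n + 1) → ZN D p₁ Q => lineFun n D p₁ Q b u = t),
        weight (qft (profileKet n D p₁ Q b v' (chirpWeight p₁ Q w))) u)
        / ∑ u, weight (qft (profileKet n D p₁ Q b v' (chirpWeight p₁ Q w))) u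
      ≤ (2 + Real.log ((p₁ * Q : ℕ+) : ℕ)) / Real.sqrt ((p₁ * Q : ℕ+) : ℕ)
          * (intervalVariation p₁ Q w A W * (∑ j, ‖w j‖) / ∑ j, ‖w j‖ ^ 2) := by
  have hP0 : (0 : ℝ) < (((p₁ * Q : ℕ+) : ℕ) : ℝ) := by exact_mod_cast PNat.pos _
  have hw0' : 0 < ∑ j, ‖w j‖ ^ 2 :=
    lt_of_le_of_ne (Finset.sum_nonneg fun j _ => by positivity) (Ne.symm hw0)
  have hL : 0 ≤ 2 + Real.log ((p₁ * Q : ℕ+) : ℕ) := by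
    have : 0 ≤ Real.log ((p₁ * Q : ℕ+) : ℕ) :=
      Real.log_nonneg (by exact_mod_cast (le_trans (by norm_num) h2 : 1 ≤ ((p₁ * Q : ℕ+) : ℕ)))
    linarith
  have hV := intervalVariation_nonneg p₁ Q w A W
  have h1 : 0 ≤ ∑ j, ‖w j‖ := Finset.sum_nonneg fun j _ => norm_nonneg _
  have hc : ∑ j, ‖chirpWeight p₁ Q w j‖ ^ 2 ≠ 0 := by rwa [sum_norm_sq_chirpWeight]
  -- the ℓ¹ bound, rewritten for the weighted chirp
  have hA := prob_profile_le_l1 n D p₁ Q b v' hP hb (chirpWeight p₁ Q w) hc t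
  have hl1 : ∑ j, ‖chirpWeight p₁ Q w j‖ = ∑ j, ‖w j‖ :=
    Finset.sum_congr rfl fun j _ => by
      rw [chirpWeight, norm_mul, ZMod.stdAddChar_apply, Circle.norm_coe, one_mul]
  rw [hl1, sum_norm_sq_chirpWeight] at hA
  have hB := prob_chirpWeight_le n D p₁ Q b v' hP h2 hb A W hW w hw hw0 t
  have h0 : 0 ≤ (∑ u ∈ Finset.univ.filter (fun u : Fin (n + 1) → ZN D p₁ Q => lineFun n D p₁ Q b u = t),
        weight (qft (profileKet n D p₁ Q b v' (chirpWeight p₁ Q w))) u)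
        / ∑ u, weight (qft (profileKet n D p₁ Q b v' (chirpWeight p₁ Q w))) u :=
    div_nonneg (Finset.sum_nonneg fun u _ => by unfold weight; positivity)
      (Finset.sum_nonneg fun u _ => by unfold weight; positivity)
  -- geometric mean of the two bounds
  have key : ∀ {x a c : ℝ}, 0 ≤ x → x ≤ a → x ≤ c → x ≤ Real.sqrt (a * c) := fun hx ha hc =>
    (Real.sqrt_sq hx).symm.le.trans
      (Real.sqrt_le_sqrt (by rw [sq]; exact mul_le_mul ha hc hx (hx.trans ha)))
  refine (key h0 hA hB).trans (le_of_eq ?_)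
  rw [show (∑ j, ‖w j‖) ^ 2 / ((((p₁ * Q : ℕ+) : ℕ) : ℝ) * ∑ j, ‖w j‖ ^ 2)
      * ((2 + Real.log ((p₁ * Q : ℕ+) : ℕ)) ^ 2 * intervalVariation p₁ Q w A W ^ 2 / ∑ j, ‖w j‖ ^ 2)
      = ((2 + Real.log ((p₁ * Q : ℕ+) : ℕ)) / Real.sqrt ((p₁ * Q : ℕ+) : ℕ)
          * (intervalVariation p₁ Q w A W * (∑ j, ‖w j‖) / ∑ j, ‖w j‖ ^ 2)) ^ 2 by
      rw [mul_pow, div_pow, div_pow, mul_pow, Real.sq_sqrt hP0.le]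
      field_simp]
  exact Real.sqrt_sq (mul_nonneg (div_nonneg hL (Real.sqrt_nonneg _))
    (div_nonneg (mul_nonneg hV h1) hw0'.le))

/-- **The same bound at an unknown relative position.** For the weight applied at ANY relative
position `j₀` to the chirp, every hyperplane value has probability
`≤ ((2 + log P)/√P)·(V(w)·‖w‖₁/‖w‖₂²)`. [cite: Korobov1992, Ch. I §2 Thm 2 and §3 Thm 3; ChenQuantumLattice2024, §3.5.9 pp. 35–38] -/
theorem prob_chirpWeight_shift_le_shape (hP : Odd ((p₁ * Q : ℕ+) : ℕ)) (h2 : 2 ≤ ((p₁ * Q : ℕ+) : ℕ))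
    (hb : b 0 = -1) (A W : ℕ) (hW : W ≤ ((p₁ * Q : ℕ+) : ℕ)) (w : ZP p₁ Q → ℂ)
    (hw : ∀ j, j ∉ intervalWindow p₁ Q A W → w j = 0) (hw0 : ∑ j, ‖w j‖ ^ 2 ≠ 0) (j₀ t : ZP p₁ Q) :
    (∑ u ∈ Finset.univ.filter (fun u : Fin (n + 1) → ZN D p₁ Q => lineFun n D p₁ Q b u = t),
        weight (qft (profileKet n D p₁ Q b v'
          (fun j => (ZMod.stdAddChar (-(j ^ 2)) : ℂ) * w (j - j₀)))) u)
        / ∑ u, weight (qft (profileKet n D p₁ Q b v'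
          (fun j => (ZMod.stdAddChar (-(j ^ 2)) : ℂ) * w (j - j₀)))) u
      ≤ (2 + Real.log ((p₁ * Q : ℕ+) : ℕ)) / Real.sqrt ((p₁ * Q : ℕ+) : ℕ)
          * (intervalVariation p₁ Q w A W * (∑ j, ‖w j‖) / ∑ j, ‖w j‖ ^ 2) := by
  have hP0 : (0 : ℝ) < (((p₁ * Q : ℕ+) : ℕ) : ℝ) := by exact_mod_cast PNat.pos _
  have hw0' : 0 < ∑ j, ‖w j‖ ^ 2 :=
    lt_of_le_of_ne (Finset.sum_nonneg fun j _ => by positivity) (Ne.symm hw0)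
  have hL : 0 ≤ 2 + Real.log ((p₁ * Q : ℕ+) : ℕ) := by
    have : 0 ≤ Real.log ((p₁ * Q : ℕ+) : ℕ) :=
      Real.log_nonneg (by exact_mod_cast (le_trans (by norm_num) h2 : 1 ≤ ((p₁ * Q : ℕ+) : ℕ)))
    linarith
  have hV := intervalVariation_nonneg p₁ Q w A W
  have h1 : 0 ≤ ∑ j, ‖w j‖ := Finset.sum_nonneg fun j _ => norm_nonneg _
  -- the shifted weighted chirp is `chirpWeight` of the translated weight
  have hcw : (fun j => (ZMod.stdAddChar (-(j ^ 2)) : ℂ) * w (j - j₀))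
      = chirpWeight p₁ Q (fun j => w (j - j₀)) := rfl
  have hws0 : ∑ j, ‖w (j - j₀)‖ ^ 2 ≠ 0 := by rwa [sum_norm_sq_sub_eq]
  have hc : ∑ j, ‖chirpWeight p₁ Q (fun j => w (j - j₀)) j‖ ^ 2 ≠ 0 := by
    rwa [sum_norm_sq_chirpWeight]
  have hA := prob_profile_le_l1 n D p₁ Q b v' hP hb (chirpWeight p₁ Q (fun j => w (j - j₀))) hc t
  have hl1 : ∑ j, ‖chirpWeight p₁ Q (fun j => w (j - j₀)) j‖ = ∑ j, ‖w j‖ := by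
    rw [← sum_norm_sub_eq p₁ Q w j₀]
    exact Finset.sum_congr rfl fun j _ => by
      rw [chirpWeight, norm_mul, ZMod.stdAddChar_apply, Circle.norm_coe, one_mul]
  rw [hl1, sum_norm_sq_chirpWeight, sum_norm_sq_sub_eq, ← hcw] at hA
  have hB := prob_chirpWeight_shift_le n D p₁ Q b v' hP h2 hb A W hW w hw hw0 j₀ t
  have h0 : 0 ≤ (∑ u ∈ Finset.univ.filter (fun u : Fin (n + 1) → ZN D p₁ Q => lineFun n D p₁ Q b u = t),
        weight (qft (profileKet n D p₁ Q b v'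
          (fun j => (ZMod.stdAddChar (-(j ^ 2)) : ℂ) * w (j - j₀)))) u)
        / ∑ u, weight (qft (profileKet n D p₁ Q b v'
          (fun j => (ZMod.stdAddChar (-(j ^ 2)) : ℂ) * w (j - j₀)))) u :=
    div_nonneg (Finset.sum_nonneg fun u _ => by unfold weight; positivity)
      (Finset.sum_nonneg fun u _ => by unfold weight; positivity)
  have key : ∀ {x a c : ℝ}, 0 ≤ x → x ≤ a → x ≤ c → x ≤ Real.sqrt (a * c) := fun hx ha hc =>
    (Real.sqrt_sq hx).symm.le.trans
      (Real.sqrt_le_sqrt (by rw [sq]; exact mul_le_mul ha hc hx (hx.trans ha)))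
  refine (key h0 hA hB).trans (le_of_eq ?_)
  rw [show (∑ j, ‖w j‖) ^ 2 / ((((p₁ * Q : ℕ+) : ℕ) : ℝ) * ∑ j, ‖w j‖ ^ 2)
      * ((2 + Real.log ((p₁ * Q : ℕ+) : ℕ)) ^ 2 * intervalVariation p₁ Q w A W ^ 2 / ∑ j, ‖w j‖ ^ 2)
      = ((2 + Real.log ((p₁ * Q : ℕ+) : ℕ)) / Real.sqrt ((p₁ * Q : ℕ+) : ℕ)
          * (intervalVariation p₁ Q w A W * (∑ j, ‖w j‖) / ∑ j, ‖w j‖ ^ 2)) ^ 2 by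
      rw [mul_pow, div_pow, div_pow, mul_pow, Real.sq_sqrt hP0.le]
      field_simp]
  exact Real.sqrt_sq (mul_nonneg (div_nonneg hL (Real.sqrt_nonneg _))
    (div_nonneg (mul_nonneg hV h1) hw0'.le))

end Line

end Literature.Computability.Cryptography.Chen2024

namespace Literature.Computability.Cryptography.Chen2024.Shape

open scoped BigOperators

variable (S : Shape)

/-- **T8 with the shape factor, every admissible shape, unknown centre**: with the chirp of `|φ8.b⟩`
seen through ANY weight `w ≠ 0` supported on an interval of `W ≤ P` line positions, applied at ANY
relative position `j₀`, every hyperplane value of one run has probability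
`≤ ((2 + log P)/√P)·(V(w)·‖w‖₁/‖w‖₂²)`. [cite: Korobov1992, Ch. I §2 Thm 2 and §3 Thm 3; ChenQuantumLattice2024, §3.5.9 pp. 35–38] -/
theorem prob_chirpWeight_le_shape (h : S.Admissible) (A W : ℕ) (hW : W ≤ (S.P : ℕ))
    (w : ZP S.p₁ S.Q → ℂ) (hw : ∀ j, j ∉ intervalWindow S.p₁ S.Q A W → w j = 0)
    (hw0 : ∑ j, ‖w j‖ ^ 2 ≠ 0) (j₀ t : ZP S.p₁ S.Q) :
    (∑ u ∈ Finset.univ.filter (fun u : Fin (S.n + 1) → ZMod S.N => lineFun S.n S.D S.p₁ S.Q S.b u = t),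
        weight (qft (profileKet S.n S.D S.p₁ S.Q S.b S.v'
          (fun j => (ZMod.stdAddChar (-(j ^ 2)) : ℂ) * w (j - j₀)))) u)
        / ∑ u, weight (qft (profileKet S.n S.D S.p₁ S.Q S.b S.v'
          (fun j => (ZMod.stdAddChar (-(j ^ 2)) : ℂ) * w (j - j₀)))) u
      ≤ (2 + Real.log (S.P : ℕ)) / Real.sqrt (S.P : ℕ)
          * (intervalVariation S.p₁ S.Q w A W * (∑ j, ‖w j‖) / ∑ j, ‖w j‖ ^ 2) :=
  Chen2024.prob_chirpWeight_shift_le_shape S.n S.D S.p₁ S.Q S.b S.v' h.odd_P h.two_le_P h.b_head A W hW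
    w hw hw0 j₀ t

end Literature.Computability.Cryptography.Chen2024.Shape
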